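import Summits.CriticalPhenomena.PercolationContinuityZ3.Theorems.PercNearOneGluingNoHeavyLowerTailThreePartitionAD

/-!
# `NoHeavyLowerTail` (crux stmt-CriticalPhenomena-4575): the LIFT OF A FAMILY ALONG AN ELEMENT and the bookkeeping of pinned
# three-partition counts (moving a pinned element between parts; the factor-three identity for `e`-free predicates)

Support file (lane `prim-ineq-gen-4`, generation 15; `--supports stmt-CriticalPhenomena-4575`).  Pure proofs, no `sorry`, standard axioms;
the only definition is the bookkeeping lift `{R : Set ι | insert e R ∈ 𝒳} = {T | insert e T ∈ 𝒳}` (the top section of a family along `e`, read as an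
`e`-free family on the same ground set).  Used by `…ThreePartitionPrincipal` (three-partition positivity with one principal slot).
Contents: `liftAt` and its algebra (`isUpperSet_liftAt`, `liftAt_inter`, `e`-freeness, `liftAt_principal_insert`); generic bookkeeping for
the partition count `tri` of `…ThreePartitionAD` (`tri_congr`, `tri_mono`, `tri_add_le`, `tri_le_add₃`, `tri_split`); the bijections
moving a pinned element from part 3 or part 1 into part 2 (`tri_move32`, `tri_move12`); slot symmetries of `tee` (`tee_swap12`,
`tee_swap13`); and the FACTOR-THREE identity `tri p = 3 · tri (e ∈ S₂ ∧ p)` for `e`-free predicates (`tri_eq_three_mul_pin`).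
Memo: `run/shared/lean/prim/prim-ineq-gen-4/FINDING-LEVEL2-CUBE-TPP-g15.md` §3. [this work]
-/

noncomputable section

open Finset
open scoped Classical

namespace Summit.CriticalPhenomena.PercolationContinuityZ3.Theorems.ThreePartition

variable {ι : Type*} [Fintype ι]

/-! ## The lift of a family along an element -/

omit [Fintype ι] in
/-- Membership in the lift. [this work] -/
theorem mem_liftAt {e : ι} {𝒳 : Set (Set ι)} {T : Set ι} : T ∈ {R : Set ι | insert e R ∈ 𝒳} ↔ insert e T ∈ 𝒳 := Iff.rfl

omit [Fintype ι] in
/-- The lift of an up-set is an up-set. [this work] -/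
theorem isUpperSet_liftAt (e : ι) {𝒳 : Set (Set ι)} (h : IsUpperSet 𝒳) : IsUpperSet ({R : Set ι | insert e R ∈ 𝒳}) :=
  fun _ _ hAB hA => h (Set.insert_subset_insert hAB) hA

omit [Fintype ι] in
/-- An up-set is contained in its lift. [this work] -/
theorem mem_liftAt_of_mem (e : ι) {𝒳 : Set (Set ι)} (h : IsUpperSet 𝒳) {T : Set ι} (hT : T ∈ 𝒳) : T ∈ {R : Set ι | insert e R ∈ 𝒳} :=
  h (Set.subset_insert e T) hT

omit [Fintype ι] in
/-- The lift commutes with intersections. [this work] -/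
theorem liftAt_inter (e : ι) (𝒳 𝒴 : Set (Set ι)) : {R : Set ι | insert e R ∈ 𝒳 ∩ 𝒴} = {R : Set ι | insert e R ∈ 𝒳} ∩ {R : Set ι | insert e R ∈ 𝒴} := rfl

omit [Fintype ι] in
/-- The lift is `e`-free (inserting `e`). [this work] -/
theorem insert_mem_liftAt_iff (e : ι) (𝒳 : Set (Set ι)) (T : Set ι) : insert e T ∈ {R : Set ι | insert e R ∈ 𝒳} ↔ T ∈ {R : Set ι | insert e R ∈ 𝒳} := by
  simp only [mem_liftAt, Set.insert_eq_of_mem (Set.mem_insert e T)]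

omit [Fintype ι] in
/-- The lift is `e`-free (deleting `e`). [this work] -/
theorem diff_mem_liftAt_iff (e : ι) (𝒳 : Set (Set ι)) (T : Set ι) : T \ {e} ∈ {R : Set ι | insert e R ∈ 𝒳} ↔ T ∈ {R : Set ι | insert e R ∈ 𝒳} := by
  simp only [mem_liftAt, Set.insert_sdiff_singleton]

omit [Fintype ι] in
/-- For a set containing `e`, membership in the lift is membership. [this work] -/
theorem mem_liftAt_iff_of_mem {e : ι} (𝒳 : Set (Set ι)) {T : Set ι} (he : e ∈ T) : T ∈ {R : Set ι | insert e R ∈ 𝒳} ↔ T ∈ 𝒳 := by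
  rw [mem_liftAt, Set.insert_eq_of_mem he]

omit [Fintype ι] in
/-- The lift of the principal filter of `insert e S` is the principal filter of `S` (`e ∉ S`). [this work] -/
theorem liftAt_principal_insert (e : ι) (S : Finset ι) (he : e ∉ S) :
    {R : Set ι | insert e R ∈ {T : Set ι | ((insert e S : Finset ι) : Set ι) ⊆ T}} = {T : Set ι | (S : Set ι) ⊆ T} := by
  ext T
  simp only [Set.mem_setOf_eq, Finset.coe_insert, Set.insert_subset_iff, Set.mem_insert_iff, true_or,
    true_and]
  constructor
  · intro h x hx
    have hx' := h hx
    rcases (Set.mem_insert_iff.1 hx') with h1 | h1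
    · exact absurd (h1 ▸ (Finset.mem_coe.1 hx)) he
    · exact h1
  · intro h x hx
    exact Set.mem_insert_of_mem e (h hx)

/-! ## Moving the pinned element between the parts of a 3-partition -/

omit [Fintype ι] in
/-- `e ∉ S`: `insert e S ∖ {e} = S`. [folklore] -/
theorem insert_sdiff_singleton_of_notMem {e : ι} {S : Set ι} (h : e ∉ S) : insert e S \ {e} = S := by
  ext x
  simp only [Set.mem_sdiff, Set.mem_insert_iff, Set.mem_singleton_iff]
  constructor
  · rintro ⟨h1 | h1, h2⟩
    · exact absurd h1 h2
    · exact h1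
  · intro hx
    exact ⟨Or.inr hx, fun hxe => h (hxe ▸ hx)⟩

omit [Fintype ι] in
/-- `e ∉ S₁ ∪ S₂`: inserting `e` into the complement of `S₁ ∪ insert e S₂` gives back `(S₁ ∪ S₂)ᶜ`. [folklore] -/
theorem insert_compl_union_insert {e : ι} {S₁ S₂ : Set ι} (h : e ∈ (S₁ ∪ S₂)ᶜ) :
    insert e (S₁ ∪ insert e S₂)ᶜ = (S₁ ∪ S₂)ᶜ := by
  ext x
  simp only [Set.mem_compl_iff, Set.mem_union, not_or] at h
  simp only [Set.mem_insert_iff, Set.mem_compl_iff, Set.mem_union, not_or]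
  by_cases hxe : x = e
  · subst hxe; tauto
  · tauto

omit [Fintype ι] in
/-- `e ∉ S₁`: the complement of `S₁ ∪ (S₂ ∖ e)` is `insert e (S₁ ∪ S₂)ᶜ`. [folklore] -/
theorem compl_union_diff_singleton {e : ι} {S₁ S₂ : Set ι} (h1 : e ∉ S₁) :
    (S₁ ∪ (S₂ \ {e}))ᶜ = insert e (S₁ ∪ S₂)ᶜ := by
  ext x
  simp only [Set.mem_compl_iff, Set.mem_union, Set.mem_sdiff, Set.mem_singleton_iff, not_or, Set.mem_insert_iff]
  by_cases hxe : x = e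
  · subst hxe; tauto
  · tauto

omit [Fintype ι] in
/-- Moving `e` from part 1 to part 2 keeps the union of the two parts. [folklore] -/
theorem diff_union_insert_eq {e : ι} {S₁ S₂ : Set ι} (h : e ∈ S₁) : (S₁ \ {e}) ∪ insert e S₂ = S₁ ∪ S₂ := by
  ext x
  simp only [Set.mem_union, Set.mem_sdiff, Set.mem_singleton_iff, Set.mem_insert_iff]
  by_cases hxe : x = e
  · subst hxe; tauto
  · tauto

/-- Move the pinned element from part 3 to part 2. [this work] -/
theorem tri_move32 (e : ι) (p : Set ι → Set ι → Set ι → Prop) :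
    tri (fun S₁ S₂ S₃ => e ∈ S₃ ∧ p S₁ S₂ S₃) = tri (fun S₁ S₂ S₃ => e ∈ S₂ ∧ p S₁ (S₂ \ {e}) (insert e S₃)) := by
  unfold tri
  refine card_bij' (fun q _ => (q.1, insert e q.2)) (fun q _ => (q.1, q.2 \ {e})) ?_ ?_ ?_ ?_
  · intro q hq
    simp only [mem_filter, mem_univ, true_and] at hq ⊢
    obtain ⟨hd, he, hp⟩ := hq
    have he1 : e ∉ q.1 := fun h => he (Or.inl h)
    have he2 : e ∉ q.2 := fun h => he (Or.inr h)
    refine ⟨?_, Set.mem_insert e q.2, ?_⟩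
    · exact Set.disjoint_insert_right.2 ⟨he1, hd⟩
    · rw [insert_sdiff_singleton_of_notMem he2, insert_compl_union_insert he]
      exact hp
  · intro q hq
    simp only [mem_filter, mem_univ, true_and] at hq ⊢
    obtain ⟨hd, he, hp⟩ := hq
    have he1 : e ∉ q.1 := fun h => Set.disjoint_left.1 hd h he
    refine ⟨?_, ?_, ?_⟩
    · exact Disjoint.mono_right Set.sdiff_subset hd
    · rw [compl_union_diff_singleton he1]
      exact Set.mem_insert e _
    · rw [compl_union_diff_singleton he1]
      exact hp
  · intro q hq
    simp only [mem_filter, mem_univ, true_and] at hq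
    have he2 : e ∉ q.2 := fun h => hq.2.1 (Or.inr h)
    ext <;> simp [insert_sdiff_singleton_of_notMem he2]
  · intro q hq
    simp only [mem_filter, mem_univ, true_and] at hq
    ext <;> simp [Set.insert_sdiff_singleton, Set.insert_eq_of_mem hq.2.1]

/-- Move the pinned element from part 1 to part 2. [this work] -/
theorem tri_move12 (e : ι) (p : Set ι → Set ι → Set ι → Prop) :
    tri (fun S₁ S₂ S₃ => e ∈ S₁ ∧ p S₁ S₂ S₃) = tri (fun S₁ S₂ S₃ => e ∈ S₂ ∧ p (insert e S₁) (S₂ \ {e}) S₃) := by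
  unfold tri
  refine card_bij' (fun q _ => (q.1 \ {e}, insert e q.2)) (fun q _ => (insert e q.1, q.2 \ {e})) ?_ ?_ ?_ ?_
  · intro q hq
    simp only [mem_filter, mem_univ, true_and] at hq ⊢
    obtain ⟨hd, he, hp⟩ := hq
    have he2 : e ∉ q.2 := fun h => Set.disjoint_left.1 hd he h
    refine ⟨?_, Set.mem_insert e q.2, ?_⟩
    · refine Set.disjoint_insert_right.2 ⟨fun h => h.2 rfl, ?_⟩
      exact Disjoint.mono_left Set.sdiff_subset hd
    · rw [Set.insert_sdiff_singleton, Set.insert_eq_of_mem he, insert_sdiff_singleton_of_notMem he2, diff_union_insert_eq he]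
      exact hp
  · intro q hq
    simp only [mem_filter, mem_univ, true_and] at hq ⊢
    obtain ⟨hd, he, hp⟩ := hq
    have he1 : e ∉ q.1 := fun h => Set.disjoint_left.1 hd h he
    refine ⟨?_, Set.mem_insert e q.1, ?_⟩
    · refine Set.disjoint_insert_left.2 ⟨fun h => h.2 rfl, ?_⟩
      exact Disjoint.mono_right Set.sdiff_subset hd
    · have : insert e q.1 ∪ q.2 \ {e} = q.1 ∪ q.2 := by
        rw [Set.union_comm, Set.union_comm q.1]
        have h' := diff_union_insert_eq (S₁ := q.2) (S₂ := q.1) he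
        exact h'
      rw [this]
      exact hp
  · intro q hq
    simp only [mem_filter, mem_univ, true_and] at hq
    have he2 : e ∉ q.2 := fun h => Set.disjoint_left.1 hq.1 hq.2.1 h
    ext <;> simp [Set.insert_sdiff_singleton, Set.insert_eq_of_mem hq.2.1, insert_sdiff_singleton_of_notMem he2]
  · intro q hq
    simp only [mem_filter, mem_univ, true_and] at hq
    have he1 : e ∉ q.1 := fun h => Set.disjoint_left.1 hq.1 h hq.2.1
    ext <;> simp [Set.insert_sdiff_singleton, Set.insert_eq_of_mem hq.2.1, insert_sdiff_singleton_of_notMem he1]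


/-! ## Generic bookkeeping for `tri` -/

/-- `tri` only depends on the predicate on genuine 3-partitions. [this work] -/
theorem tri_congr {p q : Set ι → Set ι → Set ι → Prop}
    (h : ∀ S₁ S₂ : Set ι, Disjoint S₁ S₂ → (p S₁ S₂ (S₁ ∪ S₂)ᶜ ↔ q S₁ S₂ (S₁ ∪ S₂)ᶜ)) : tri p = tri q := by
  unfold tri
  congr 1
  refine filter_congr fun x _ => ?_
  constructor
  · rintro ⟨hd, hp⟩; exact ⟨hd, (h _ _ hd).1 hp⟩
  · rintro ⟨hd, hq⟩; exact ⟨hd, (h _ _ hd).2 hq⟩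

/-- Monotonicity of `tri` in the predicate. [this work] -/
theorem tri_mono {p q : Set ι → Set ι → Set ι → Prop}
    (h : ∀ S₁ S₂ : Set ι, Disjoint S₁ S₂ → p S₁ S₂ (S₁ ∪ S₂)ᶜ → q S₁ S₂ (S₁ ∪ S₂)ᶜ) : tri p ≤ tri q := by
  unfold tri
  refine card_le_card fun x hx => ?_
  simp only [mem_filter, mem_univ, true_and] at hx ⊢
  exact ⟨hx.1, h _ _ hx.1 hx.2⟩

/-- Two incompatible sub-predicates: `tri p + tri q ≤ tri r`. [this work] -/
theorem tri_add_le {p q r : Set ι → Set ι → Set ι → Prop}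
    (hp : ∀ S₁ S₂ S₃, p S₁ S₂ S₃ → r S₁ S₂ S₃) (hq : ∀ S₁ S₂ S₃, q S₁ S₂ S₃ → r S₁ S₂ S₃)
    (hpq : ∀ S₁ S₂ S₃, p S₁ S₂ S₃ → ¬ q S₁ S₂ S₃) : tri p + tri q ≤ tri r := by
  unfold tri
  rw [← card_union_of_disjoint]
  · refine card_le_card fun x hx => ?_
    simp only [mem_union, mem_filter, mem_univ, true_and] at hx ⊢
    rcases hx with ⟨hd, h⟩ | ⟨hd, h⟩
    · exact ⟨hd, hp _ _ _ h⟩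
    · exact ⟨hd, hq _ _ _ h⟩
  · rw [disjoint_filter]
    intro x _ h1 h2
    exact hpq _ _ _ h1.2 h2.2

/-- A predicate covered by three others: `tri r ≤ tri p + tri q + tri s`. [this work] -/
theorem tri_le_add₃ {p q s r : Set ι → Set ι → Set ι → Prop}
    (h : ∀ S₁ S₂ S₃, r S₁ S₂ S₃ → p S₁ S₂ S₃ ∨ q S₁ S₂ S₃ ∨ s S₁ S₂ S₃) : tri r ≤ tri p + tri q + tri s := by
  unfold tri
  refine le_trans (card_le_card fun x hx => ?_) (le_trans (card_union_le _ _) (Nat.add_le_add_right (card_union_le _ _) _))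
  simp only [mem_union, mem_filter, mem_univ, true_and] at hx ⊢
  rcases h _ _ _ hx.2 with h1 | h1 | h1
  · exact Or.inl (Or.inl ⟨hx.1, h1⟩)
  · exact Or.inl (Or.inr ⟨hx.1, h1⟩)
  · exact Or.inr ⟨hx.1, h1⟩

/-- Splitting a count by the position of `e`. [this work] -/
theorem tri_split (e : ι) (p : Set ι → Set ι → Set ι → Prop) :
    tri p = tri (fun S₁ S₂ S₃ => e ∈ S₁ ∧ p S₁ S₂ S₃) + tri (fun S₁ S₂ S₃ => e ∈ S₂ ∧ p S₁ S₂ S₃)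
      + tri (fun S₁ S₂ S₃ => e ∈ S₃ ∧ p S₁ S₂ S₃) := by
  unfold tri
  rw [← card_filter_add_card_filter_not (fun q : Set ι × Set ι => e ∈ q.1)]
  rw [← card_filter_add_card_filter_not (s := filter (fun q : Set ι × Set ι => ¬ e ∈ q.1) _)
    (fun q : Set ι × Set ι => e ∈ q.2)]
  simp only [filter_filter]
  have h1 : (filter (fun q : Set ι × Set ι => (Disjoint q.1 q.2 ∧ p q.1 q.2 (q.1 ∪ q.2)ᶜ) ∧ e ∈ q.1) univ).card =
      (filter (fun q : Set ι × Set ι => Disjoint q.1 q.2 ∧ e ∈ q.1 ∧ p q.1 q.2 (q.1 ∪ q.2)ᶜ) univ).card := by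
    congr 1; refine filter_congr fun x _ => ?_; tauto
  have h2 : (filter (fun q : Set ι × Set ι => ((Disjoint q.1 q.2 ∧ p q.1 q.2 (q.1 ∪ q.2)ᶜ) ∧ ¬ e ∈ q.1) ∧ e ∈ q.2) univ).card =
      (filter (fun q : Set ι × Set ι => Disjoint q.1 q.2 ∧ e ∈ q.2 ∧ p q.1 q.2 (q.1 ∪ q.2)ᶜ) univ).card := by
    congr 1; refine filter_congr fun x _ => ?_
    constructor
    · rintro ⟨⟨⟨hd, hp⟩, _⟩, h2⟩; exact ⟨hd, h2, hp⟩
    · rintro ⟨hd, h2, hp⟩; exact ⟨⟨⟨hd, hp⟩, fun h1 => Set.disjoint_left.1 hd h1 h2⟩, h2⟩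
  have h3 : (filter (fun q : Set ι × Set ι => ((Disjoint q.1 q.2 ∧ p q.1 q.2 (q.1 ∪ q.2)ᶜ) ∧ ¬ e ∈ q.1) ∧ ¬ e ∈ q.2) univ).card =
      (filter (fun q : Set ι × Set ι => Disjoint q.1 q.2 ∧ e ∈ (q.1 ∪ q.2)ᶜ ∧ p q.1 q.2 (q.1 ∪ q.2)ᶜ) univ).card := by
    congr 1; refine filter_congr fun x _ => ?_
    simp only [Set.mem_compl_iff, Set.mem_union, not_or]
    tauto
  rw [h1, h2, h3]
  ring

/-- `tee` is symmetric in its first two families (swap parts 1 and 2). [this work] -/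
theorem tee_swap12 (𝒳 𝒴 𝒵 : Set (Set ι)) : tee 𝒳 𝒴 𝒵 = tee 𝒴 𝒳 𝒵 := by
  unfold tee tri
  refine card_bij' (fun q _ => (q.2, q.1)) (fun q _ => (q.2, q.1)) ?_ ?_ (fun q _ => rfl) (fun q _ => rfl)
  · intro q hq
    simp only [mem_filter, mem_univ, true_and] at hq ⊢
    exact ⟨hq.1.symm, hq.2.2.1, hq.2.1, by rw [Set.union_comm]; exact hq.2.2.2⟩
  · intro q hq
    simp only [mem_filter, mem_univ, true_and] at hq ⊢
    exact ⟨hq.1.symm, hq.2.2.1, hq.2.1, by rw [Set.union_comm]; exact hq.2.2.2⟩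

/-- `tee` is symmetric in its first and third families (swap parts 1 and 3). [this work] -/
theorem tee_swap13 (𝒳 𝒴 𝒵 : Set (Set ι)) : tee 𝒳 𝒴 𝒵 = tee 𝒵 𝒴 𝒳 := by
  unfold tee tri
  refine card_bij' (fun q _ => ((q.1 ∪ q.2)ᶜ, q.2)) (fun q _ => ((q.1 ∪ q.2)ᶜ, q.2)) ?_ ?_ ?_ ?_
  · intro q hq
    simp only [mem_filter, mem_univ, true_and] at hq ⊢
    obtain ⟨hd, h1, h2, h3⟩ := hq
    refine ⟨Set.disjoint_left.2 fun x hx hx2 => hx (Or.inr hx2), h3, h2, ?_⟩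
    rw [compl_union_compl_union_eq hd]; exact h1
  · intro q hq
    simp only [mem_filter, mem_univ, true_and] at hq ⊢
    obtain ⟨hd, h1, h2, h3⟩ := hq
    refine ⟨Set.disjoint_left.2 fun x hx hx2 => hx (Or.inr hx2), h3, h2, ?_⟩
    rw [compl_union_compl_union_eq hd]; exact h1
  · intro q hq
    simp only [mem_filter, mem_univ, true_and] at hq
    exact Prod.ext (compl_union_compl_union_eq hq.1) rfl
  · intro q hq
    simp only [mem_filter, mem_univ, true_and] at hq
    exact Prod.ext (compl_union_compl_union_eq hq.1) rfl

/-- FACTOR THREE: for an `e`-free predicate the count is three times the count with `e` pinned into part 2. [this work] -/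
theorem tri_eq_three_mul_pin (e : ι) (p : Set ι → Set ι → Set ι → Prop)
    (h1 : ∀ S₁ S₂ S₃, p (insert e S₁) (S₂ \ {e}) S₃ ↔ p S₁ S₂ S₃)
    (h3 : ∀ S₁ S₂ S₃, p S₁ (S₂ \ {e}) (insert e S₃) ↔ p S₁ S₂ S₃) :
    tri p = 3 * tri (fun S₁ S₂ S₃ => e ∈ S₂ ∧ p S₁ S₂ S₃) := by
  rw [tri_split e p, tri_move12 e p, tri_move32 e p]
  have ha : tri (fun S₁ S₂ S₃ => e ∈ S₂ ∧ p (insert e S₁) (S₂ \ {e}) S₃) = tri (fun S₁ S₂ S₃ => e ∈ S₂ ∧ p S₁ S₂ S₃) :=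
    tri_congr fun S₁ S₂ _ => by rw [h1]
  have hb : tri (fun S₁ S₂ S₃ => e ∈ S₂ ∧ p S₁ (S₂ \ {e}) (insert e S₃)) = tri (fun S₁ S₂ S₃ => e ∈ S₂ ∧ p S₁ S₂ S₃) :=
    tri_congr fun S₁ S₂ _ => by rw [h3]
  rw [ha, hb]
  ring


end Summit.CriticalPhenomena.PercolationContinuityZ3.Theorems.ThreePartition
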